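import Literature.NumberTheory.LFunctions.CsordasSmithVargaLehmerPairs
import Literature.NumberTheory.LFunctions.EquivalentsHolds
import Literature.NumberTheory.LFunctions.RodgersTaoZeroSet
import HarnessLib

/-!
# Csordas–Smith–Varga 1994, Lehmer pairs: discharge of the printed bound, records, indexed form

RH-FREE LITERATURE (label line, cell rh-crit C3), companion PROOFS file of
`CsordasSmithVargaLehmerPairs.lean` (which types CSV's Definition / Theorem 1 from the held
secondaries Saouter–Gourdon–Demichel 2011, Def. A / Thm. A p. 2282, and Stopple 2016 §3). Nothing
here bears on the truth of RH. Contents: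

* `csordasSmithVarga_lehmerPair_bound_holds` — discharge of the named fact
  `Literature.NumberTheory.LFunctions.csordasSmithVarga_lehmerPair_bound` (a Lehmer pair `(a, b)` of
  `H_0` gives `λ ≤ Λ`). **DOMINATED discharge, 0 Csordas–Smith–Varga content:** `λ ≤ 0`
  (`IsLehmerPair.lehmerPairBound_nonpos`) and `0 ≤ Λ` is the tree's THEOREM
  `Literature.NumberTheory.LFunctions.deBruijnNewmanConst_nonneg_holds` (Rodgers–Tao 2020 Thm. 1.1,
  proved along Dobner 2021). The printed zero-dynamics proof (CSV Lemmas 2.1/2.4/2.5, sketched in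
  the module docstring of the statements file) is NOT formalised; its time-translated, content-bearing
  form "Lehmer pair of `H_{t₀}` ⇒ `t₀ + λ ≤ Λ`" is not printed in the held sources and stays untyped.
* `deBruijnNewmanConst_lowerBound_records` — the lower-bound records of Rodgers–Tao 2020 Table 1
  (`−50`, `−5`, `−0.385`, `−0.0991`, `−4.379·10⁻⁶`, `−5.895·10⁻⁹`, `−2.63·10⁻⁹`, `−1.15·10⁻¹¹`)
  and Saouter–Gourdon–Demichel's `Λ > −1.14541·10⁻¹¹` (abstract, §5 p. 2285), all derived from
  `0 ≤ Λ` (likewise DOMINATED; no numerics are re-run, nothing is certified about the champion pair).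
* `isLehmerPair_deBruijnZero_iff`, `IsLehmerPair.exists_eq_deBruijnZero` — for `t > Λ`
  (`sInf`-free: some `H_{t₁}`, `t₁ < t`, has only real zeros) the abscissa rendering `IsLehmerPair`
  agrees with SGD's indexed Definition A read at time `t`, via the tree's enumeration
  `Literature.NumberTheory.LFunctions.deBruijnZero` (`RodgersTaoEnergy.lean`, `RodgersTaoZeroSet.lean`:
  `strictMono_deBruijnZero`, `exists_deBruijnZero_eq`, `deriv_deBruijnH_deBruijnZero_ne_zero`).

## References

* G. Csordas, W. Smith, R. S. Varga, *Lehmer pairs of zeros, the de Bruijn–Newman constant `Λ`, and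
  the Riemann Hypothesis*, Constr. Approx. 10 (1994) 107–129, Theorem 1. [CsordasSmithVarga1994]
* Y. Saouter, X. Gourdon, P. Demichel, *An improved lower bound for the de Bruijn–Newman constant*,
  Math. Comp. 80 (2011) 2281–2287, Def. A / Thm. A p. 2282, abstract and §5 p. 2285.
  [SaouterGourdonDemichel2011]
* B. Rodgers, T. Tao, *The de Bruijn–Newman constant is non-negative*, Forum Math. Pi 8 (2020) e6,
  §1 Table 1, Thm. 1.1. [RodgersTaoFMP2020]
-/

noncomputable section

open Complex Set

namespace Literature.NumberTheory.LFunctions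

/-! ## The printed bound, discharged (dominated by `0 ≤ Λ`) -/

/-- **Discharge of `csordasSmithVarga_lehmerPair_bound` — DOMINATED (0 CSV content):** for a Lehmer
pair the printed bound satisfies `λ ≤ 0` (`IsLehmerPair.lehmerPairBound_nonpos`), and `0 ≤ Λ` is the
tree's theorem `deBruijnNewmanConst_nonneg_holds` (Rodgers–Tao 2020 Thm. 1.1 via Dobner 2021).
This route does NOT formalise the Csordas–Smith–Varga zero-dynamics argument (module docstring of
`CsordasSmithVargaLehmerPairs.lean`); it records that the printed statement is a consequence of a
tree theorem. [cite: SaouterGourdonDemichel2011, Thm. A p. 2282] -/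
theorem csordasSmithVarga_lehmerPair_bound_holds : csordasSmithVarga_lehmerPair_bound :=
  fun _ _ hab ↦ hab.lehmerPairBound_nonpos.trans deBruijnNewmanConst_nonneg_holds

/-- **The printed lower-bound records for `Λ`, 1988–2011** (Rodgers–Tao 2020, Table 1 "Previous
lower bounds on `Λ`": `−50` Csordas–Norfolk–Varga 1988, `−5` te Riele 1991, `−0.385`
Norfolk–Ruttan–Varga 1992, `−0.0991` Csordas–Ruttan–Varga 1991, `−4.379·10⁻⁶` Csordas–Smith–Varga
1994, `−5.895·10⁻⁹` Csordas–Odlyzko–Smith–Varga 1993, `−2.63·10⁻⁹` Odlyzko 2000, `−1.15·10⁻¹¹`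
Saouter–Gourdon–Demichel 2011 — "the final four results use the method of Csordas, Smith, and
Varga"), and the sharper printed form `Λ > −1.14541·10⁻¹¹` of the last (Saouter–Gourdon–Demichel
2011, abstract and §5 p. 2285). All are DOMINATED by the tree's theorem `0 ≤ Λ`
(`deBruijnNewmanConst_nonneg_holds`), from which they are derived here; no numerics are re-run.
[cite: RodgersTaoFMP2020, §1 Table 1] [cite: SaouterGourdonDemichel2011, Abstract and §5 p. 2285] -/
theorem deBruijnNewmanConst_lowerBound_records :
    (-50 : ℝ) < deBruijnNewmanConst ∧ (-5 : ℝ) < deBruijnNewmanConst ∧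
    (-0.385 : ℝ) < deBruijnNewmanConst ∧ (-0.0991 : ℝ) < deBruijnNewmanConst ∧
    (-4.379e-6 : ℝ) < deBruijnNewmanConst ∧ (-5.895e-9 : ℝ) < deBruijnNewmanConst ∧
    (-2.63e-9 : ℝ) < deBruijnNewmanConst ∧ (-1.15e-11 : ℝ) < deBruijnNewmanConst ∧
    (-1.14541e-11 : ℝ) < deBruijnNewmanConst := by
  have h : (0 : ℝ) ≤ deBruijnNewmanConst := deBruijnNewmanConst_nonneg_holds
  refine ⟨?_, ?_, ?_, ?_, ?_, ?_, ?_, ?_, ?_⟩ <;> exact lt_of_lt_of_le (by norm_num) h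

/-! ## The indexed form (SGD Definition A) for `t > Λ` -/

/-- **Abscissa form = indexed form for `t > Λ`.** When some `H_{t₁}`, `t₁ < t`, has only real zeros
(`Λ < t` in `sInf`-free form), the tree's enumeration `0 < x_1(t) < x_2(t) < ⋯` of the positive zeros
of `H_t` (`deBruijnZero`, `RodgersTaoEnergy.lean` / `RodgersTaoZeroSet.lean`) consists of simple zeros
(Csordas–Smith–Varga, `deriv_deBruijnH_deBruijnZero_ne_zero`) and exhausts the positive zeros
(`exists_deBruijnZero_eq`), so `(x_k(t), x_{k+1}(t))` is a Lehmer pair in the sense of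
`IsLehmerPair` iff `k ≥ 1` and `(x_{k+1}(t) − x_k(t))² · G < 4/5` — Saouter–Gourdon–Demichel's
Definition A read at time `t`. [cite: SaouterGourdonDemichel2011, Def. A p. 2282] -/
theorem isLehmerPair_deBruijnZero_iff {t : ℝ}
    (hΛ : ∃ t₁ : ℝ, t₁ < t ∧ HasOnlyRealZeros (deBruijnH t₁)) (k : ℕ) :
    IsLehmerPair t (deBruijnZero t k) (deBruijnZero t (k + 1)) ↔
      1 ≤ k ∧ (deBruijnZero t (k + 1) - deBruijnZero t k) ^ 2 *
        lehmerPairSum t (deBruijnZero t k) (deBruijnZero t (k + 1)) < 4 / 5 := by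
  constructor
  · intro h
    refine ⟨?_, h.sq_mul_lt⟩
    rcases Nat.eq_zero_or_pos k with rfl | hk
    · exact absurd h.pos (by simp)
    · exact hk
  · rintro ⟨hk, hlt⟩
    have hmono := strictMono_deBruijnZero hΛ
    exact
      { pos := deBruijnZero_pos hΛ hk
        lt := hmono (Nat.lt_succ_self k)
        zero_left := deBruijnH_deBruijnZero hΛ hk
        zero_right := deBruijnH_deBruijnZero hΛ (Nat.le_succ_of_le hk)
        simple_left := deriv_deBruijnH_deBruijnZero_ne_zero hΛ hk
        simple_right := deriv_deBruijnH_deBruijnZero_ne_zero hΛ (Nat.le_succ_of_le hk)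
        consecutive := by
          intro x hx1 hx2 hx
          obtain ⟨j, -, rfl⟩ := exists_deBruijnZero_eq hΛ ((deBruijnZero_pos hΛ hk).trans hx1) hx
          have h1 : k < j := hmono.lt_iff_lt.1 hx1
          have h2 : j < k + 1 := hmono.lt_iff_lt.1 hx2
          omega
        sq_mul_lt := hlt }

/-- In particular, for `t > Λ` the two abscissae of ANY Lehmer pair of `H_t` are consecutive terms
`x_k(t) < x_{k+1}(t)` of the enumeration (the converse reading of Definition A).
[cite: SaouterGourdonDemichel2011, Def. A p. 2282] -/
theorem IsLehmerPair.exists_eq_deBruijnZero {t a b : ℝ}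
    (hΛ : ∃ t₁ : ℝ, t₁ < t ∧ HasOnlyRealZeros (deBruijnH t₁)) (h : IsLehmerPair t a b) :
    ∃ k : ℕ, 1 ≤ k ∧ deBruijnZero t k = a ∧ deBruijnZero t (k + 1) = b := by
  obtain ⟨k, hk, rfl⟩ := exists_deBruijnZero_eq hΛ h.pos h.zero_left
  obtain ⟨j, hj, rfl⟩ := exists_deBruijnZero_eq hΛ h.pos_right h.zero_right
  have hmono := strictMono_deBruijnZero hΛ
  have hkj : k < j := hmono.lt_iff_lt.1 h.lt
  refine ⟨k, hk, rfl, ?_⟩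
  by_contra hne
  have hlt : k + 1 < j := lt_of_le_of_ne hkj fun h' ↦ hne (congrArg _ h')
  exact h.consecutive _ (hmono (Nat.lt_succ_self k)) (hmono hlt)
    (deBruijnH_deBruijnZero hΛ (Nat.le_succ_of_le hk))

end Literature.NumberTheory.LFunctions

end
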